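import Summits.BirchSwinnertonDyer.BirchSwinnertonDyer.Theorems.KolyvaginRoadThreeMethod2KolyvaginTransverseIsotropy
import Summits.BirchSwinnertonDyer.Rank1Residual.X11b.KolyvaginRingClassTotalRamification
import Summits.BirchSwinnertonDyer.Rank1Residual.X11b.KolyvaginRingClassCardinality
import Summits.BirchSwinnertonDyer.Rank1Residual.X11b.LocalTrivialityBridge
import Literature.NumberTheory.GaloisRepresentations.CompletionRestrictionRange
import Literature.NumberTheory.GaloisRepresentations.GaloisRepUnramifiedProofs
import Literature.NumberTheory.GaloisCohomology.KolyvaginSystems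
import HarnessLib

/-!
# T1 JET (cell `bsd-jet`), road K: the LOCAL GALOIS PICTURE of Jetchev's transverse condition
# `H¹_tr(K_λ, M) = ker(H¹(K_λ, M) → H¹(K[ℓ]_{w'}, M))` at a Kolyvagin prime `λ = (ℓ)` —
# the character `Φ : Γ_{K_λ} → G_ℓ = Gal(K[ℓ]/K[1])`, onto already on inertia, whose kernel is
# `Γ_{K[ℓ]_{w'}}` for EVERY `w' ∣ λ` (typer seat `bsd-jet-ty` g7; helper of the H63 line, 0 classes move)

HONEST FRAMING (programme file §HONESTY, verbatim): «no tranche here proves BSD; ARM L moves the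
LITERAL column of an r ≤ 1 census into the kernel-proved-modulo-named-print column.» THEOREMS ONLY
(no definition, no named fact, no `sorry`); nothing is booked; typed ≠ proved ≠ endorsed.

WHAT. Input (T1-K) for the KERNEL discharge of the binder `h𝒯sd` («the intrinsic transverse
condition is Lagrangian», Howard 2004 Prop. 2.1.9 (ii) = Mazur–Rubin Prop. 1.3.2 (ii)) of
`JET.tamagawaExponent_le_mInfty_of_localFacts'` (`Theorems/Rank1ResidualJetThm63LocalFactsPrime`):
the local Galois theory of the completion `K[ℓ]_{w'}/K_λ` of the ring class field at a Kolyvagin prime.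
For `K` imaginary quadratic, `ι : K → ℂ`, `ℓ` a Kolyvagin prime of W. Zhang (`Zhang2014.IsKolyvaginPrime`:
`ℓ ∤ N d_K p` prime, `λ = (ℓ)` prime in `𝓞 K`), `v = λ`, and a `K`-embedding `e₀ : K[ℓ] → K̄`:
* §0 `mem_transverseSubgroup_iff_exists_forall_range` — for ANY field `F`, discrete `Γ_F`-module `M` and
  `F`-algebra `L`: `[φ] ∈ H¹_tr(F, M) = ker(H¹(F, M) → H¹(L, M))` iff `φ` is PRINCIPAL on the image of
  `Γ_L → Γ_F` (`X11b.LocBridge.map_oneCocycleClass_eq_zero_iff`); with the place-independence of that image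
  (`SemiLocal.mem_range_absGaloisRestrict_adicCompletion_iff`, Cassels–Fröhlich VII §1.1) the transverse
  subgroup `transverseSubgroup (M|_{K_v}) (E_{w'})` of a Galois `E/K` does not depend on `w' ∣ v`
  (`transverseSubgroup_adicCompletion_eq_of_liesOver`).
* §1 `smul_ringClassFieldOne_eq_self_of_mem_decompositionSubgroup` — the decomposition group of any prime
  `𝔓 ∣ λ` of `\bar ℤ_K` fixes every embedded `K[1]` (`λ = (ℓ)` is principal: it splits completely in the
  Hilbert class field; general-`p` form of `KolyLocal.smul_ringClassFieldOne_eq_self_of_mem_decompositionSubgroup`,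
  which is the same statement with `p = 3` hard-wired — same proof).
* §2 `hasGoodReductionAt_of_zhangKolyvagin`, `toLocal_apply_eq_of_mem_absInertia` — `E/K` has good reduction at
  `λ ∤ p`, so the local inertia group acts trivially on `E[p^k]` (Silverman VII.4.1).
* §3 `exists_ringClassCharacter` — THE CHARACTER: a homomorphism `Φ : Γ_{K_λ} →* G_ℓ`
  (`G_ℓ = ringClassGalOver ι ℓ 1 = Gal(K[ℓ]/K[1])`, cyclic of order `ℓ + 1`) with
  (a) `Φ d = 1 ↔ res d` fixes `e₀(K[ℓ])` pointwise `↔ d ∈ range(Γ_{K[ℓ]_{w'}} → Γ_{K_λ})` for every `w' ∣ λ`;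
  (b) `Φ` is ONTO ALREADY ON THE INERTIA GROUP `I_{K_λ}` (Gross §3: `λ` totally ramified in `K[ℓ]/K[1]`,
  tree `RingClassTower.exists_mem_inertia_smul_eq_of_mem_ringClassGalOver` + Neukirch II (9.6)
  `I_𝔓 = res I_{K_λ}`); hence (c) `Γ_{K_λ} = I_{K_λ} · ker Φ`.
These are exactly the inputs of Mazur–Rubin's mechanism (isotropy by the cyclic quotient, Lagrangian by
counting) run in the sibling `JET/RingClassTransverseLagrangian.lean`.

References: [cite: Howard2004HeegnerKolyvagin, Prop. 2.1.9 (ii), §2.2] [cite: MazurRubin2004, Def. 1.1.6,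
Prop. 1.3.2 (ii)] [cite: GrossLMS1991, §3 (p. 218 l. 1), §4] [cite: CasselsFrohlichANT1967, Ch. VII §1.1]
[cite: NeukirchANT1999, Ch. II §9 Prop. (9.6)] [cite: SilvermanAEC2009, Prop. VII.4.1] [cite: WZhang2014,
Notations (xii)].

## Tree search
`lean search 'transverseSubgroup.*ringClassField|ringClassCharacter|KolyLocal'`: the `p = 3` Method-2 files
(`KolyvaginRoadThreeMethod2KolyvaginLocalFrobenius/TransverseIsotropy`, GLOBAL transverse classes at `p = 3`),
pv-2's `localization_mem_transverseSubgroup_iff` (global classes only); no local statement at level `p^k` —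
this file supplies it.
-/

set_option autoImplicit false

noncomputable section

open scoped Classical Pointwise Valued

namespace Summit.BirchSwinnertonDyer.Rank1Residual.JET.RingClassTransverse

open CategoryTheory WeierstrassCurve Field Function NumberField IsDedekindDomain
open Literature.NumberTheory.EllipticCurves Literature.NumberTheory.GaloisRepresentations
open Literature.NumberTheory.GaloisRepresentations.DiscreteGaloisModule (transverseSubgroup)
open Literature.NumberTheory.Automorphic
open Summit.BirchSwinnertonDyer.Rank1Residual.X11b
open Summit.BirchSwinnertonDyer.Rank1Residual.X11b.Three.Koly.Method2
open scoped ContRepresentation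

/-! ## §0 Transverse classes are the classes principal on the image of `Γ_L → Γ_F` -/

section Transverse

universe u

variable {F : Type u} [Field F] {M : Type u} [AddCommGroup M] [TopologicalSpace M] [DiscreteTopology M]

/-- **Membership in the `L`-transverse subgroup**: the class of the cocycle `φ` dies in `H¹(L, M)` iff `φ`
is principal on the image of `Γ_L → Γ_F` (the kernel of a pull-back only depends on the image of the group
map; `X11b.LocBridge.map_oneCocycleClass_eq_zero_iff`). [cite: MazurRubin2004, Def. 1.1.6]
[cite: Rubin2011, Def. 1.9.4 (p. 14)] -/
theorem mem_transverseSubgroup_iff_exists_forall_range (ρ : DiscreteGaloisModule F M) (L : Type u)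
    [Field L] [Algebra F L] (φ : contOneCocycles ρ.toTopRep) :
    oneCocycleClass ρ.toTopRep φ ∈ transverseSubgroup ρ L ↔
      ∃ x : M, ∀ g ∈ Set.range (absGaloisRestrict F L), φ.1 g = ρ g x - x := by
  refine (DiscreteGaloisModule.mem_transverseSubgroup_iff ρ L _).trans ?_
  refine (LocBridge.map_oneCocycleClass_eq_zero_iff ρ.toTopRep
    (DiscreteGaloisModule.toTopRep (GaloisRep.restrictField L ρ)) (absGaloisRestrict F L)
    (TopRep.ofHom ⟨ContinuousLinearMap.id ℤ M, fun _ => rfl⟩) Function.bijective_id φ).trans ?_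
  constructor
  · rintro ⟨x, hx⟩
    refine ⟨x, ?_⟩
    rintro _ ⟨l, rfl⟩
    exact hx l
  · rintro ⟨x, hx⟩
    exact ⟨x, fun l => hx _ ⟨l, rfl⟩⟩

end Transverse

/-- **The transverse subgroup `ker(H¹(K_v, M) → H¹(E_{w'}, M))` does not depend on the place `w' ∣ v`**
of the Galois extension `E/K` (all the images `Γ_{E_{w'}} → Γ_{K_v}` are the group of the compositum
`K_v(E)`, `SemiLocal.range_absGaloisRestrict_adicCompletion_eq_of_liesOver`). [cite: CasselsFrohlichANT1967, Ch. VII §1.1]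
[cite: MazurRubin2004, Def. 1.1.6] -/
theorem transverseSubgroup_adicCompletion_eq_of_liesOver {K : Type} [Field K] [NumberField K]
    {M : Type} [AddCommGroup M] [TopologicalSpace M] [DiscreteTopology M] (ρ : DiscreteGaloisModule K M)
    (E : Type) [Field E] [NumberField E] [Algebra K E] [IsGalois K E] (v : HeightOneSpectrum (𝓞 K))
    (w₁ w₂ : HeightOneSpectrum (𝓞 E)) [w₁.asIdeal.LiesOver v.asIdeal] [w₂.asIdeal.LiesOver v.asIdeal] :
    (letI := (adicCompletionOfLiesOver K E v w₁).toAlgebra;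
      transverseSubgroup (GaloisRep.toLocal v ρ) (w₁.adicCompletion E)) =
    (letI := (adicCompletionOfLiesOver K E v w₂).toAlgebra;
      transverseSubgroup (GaloisRep.toLocal v ρ) (w₂.adicCompletion E)) := by
  have hr := SemiLocal.range_absGaloisRestrict_adicCompletion_eq_of_liesOver (K := K) (E := E) v w₁ w₂
  ext c
  obtain ⟨φ, rfl⟩ := oneCocycleClass_surjective _ c
  letI := (adicCompletionOfLiesOver K E v w₁).toAlgebra
  letI := (adicCompletionOfLiesOver K E v w₂).toAlgebra
  constructor
  · intro h
    obtain ⟨x, hx⟩ :=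
      (mem_transverseSubgroup_iff_exists_forall_range (GaloisRep.toLocal v ρ) (w₁.adicCompletion E) φ).1 h
    exact (mem_transverseSubgroup_iff_exists_forall_range (GaloisRep.toLocal v ρ) (w₂.adicCompletion E) φ).2
      ⟨x, fun g hg => hx g (by rw [hr]; exact hg)⟩
  · intro h
    obtain ⟨x, hx⟩ :=
      (mem_transverseSubgroup_iff_exists_forall_range (GaloisRep.toLocal v ρ) (w₂.adicCompletion E) φ).1 h
    exact (mem_transverseSubgroup_iff_exists_forall_range (GaloisRep.toLocal v ρ) (w₁.adicCompletion E) φ).2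
      ⟨x, fun g hg => hx g (by rw [← hr]; exact hg)⟩

variable (W : WeierstrassCurve ℚ) (K : Type) [Field K] [NumberField K] [W.IsElliptic] [W.IsGloballyMinimal]

/-! ## §1 The decomposition group at `λ = (ℓ)` fixes the embedded Hilbert class field `K[1]` -/

omit [W.IsElliptic] [W.IsGloballyMinimal] in
/-- **`G_𝔓` fixes `K[1] ⊆ K̄` pointwise, `𝔓` any prime of `\bar ℤ_K` above the place `λ = (ℓ)` of an inert
rational prime `ℓ`** (any `K`-embedding `e₁ : K[1] → K̄`): `λ` is principal, so splits completely in the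
Hilbert class field (`mem_splitPrimes_ringClassField_of_span_natCast`); a Frobenius `F` at `𝔓` fixes `e₁(K[1])`
(`smul_algHom_eq_self_of_mem_splitPrimes`), so does `i·F` for `i` in the inertia group, and
`G_𝔓 = ⟨F⟩ · I_𝔓 · U` for the open subgroup `U` fixing `e₁(K[1])` (`exists_eq_frobenius_pow_mul_of_mem_decompositionSubgroup`).
General-`p` form of `KolyLocal.smul_ringClassFieldOne_eq_self_of_mem_decompositionSubgroup` (same proof).
[cite: GrossLMS1991, §3] [cite: Cox2013, Thm. 11.1 / Cor. 5.25] -/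
theorem smul_ringClassFieldOne_eq_self_of_mem_decompositionSubgroup (hK : IsImaginaryQuadratic K)
    (ι : K →+* ℂ) {ℓ : ℕ} (hℓp : ℓ.Prime) (hℓP : (Ideal.span {(ℓ : 𝓞 K)}).IsPrime)
    (w : HeightOneSpectrum (𝓞 K)) (hw : (ℓ : 𝓞 K) ∈ w.asIdeal) {𝔓 : Ideal (absIntegers (𝓞 K) K)}
    (h𝔓 : 𝔓 ∈ w.primesAbove) (e₁ : ringClassField K ι 1 →ₐ[K] AlgebraicClosure K) {d : absoluteGaloisGroup K}
    (hd : d ∈ 𝔓.decompositionSubgroup (absoluteGaloisGroup K)) (y : ringClassField K ι 1) :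
    d • e₁ y = e₁ y := by
  haveI := (finiteDimensional_and_isGalois_ringClassField hK ι one_ne_zero).1
  haveI := (finiteDimensional_and_isGalois_ringClassField hK ι one_ne_zero).2
  haveI : NumberField (ringClassField K ι 1) := NumberField.of_module_finite K _
  -- `w = (ℓ)` splits completely in `K[1]`
  have hwℓ : w.asIdeal = Ideal.span {((ℓ : ℕ) : 𝓞 K)} := by
    have hne : Ideal.span {(ℓ : 𝓞 K)} ≠ ⊥ := by
      rw [Ne, Ideal.span_singleton_eq_bot]; exact_mod_cast hℓp.ne_zero
    exact ((hℓP.isMaximal hne).eq_of_le w.isPrime.ne_top ((Ideal.span_singleton_le_iff_mem _).mpr hw)).symm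
  have hsplit : w ∈ splitPrimes K (ringClassField K ι 1) :=
    mem_splitPrimes_ringClassField_of_span_natCast hK ι one_ne_zero hwℓ (Nat.coprime_one_right ℓ)
  -- Frobenius elements at `𝔓` fix `e₁(K[1])`; so do inertia elements (`i = (iF)F⁻¹`)
  obtain ⟨F, hF⟩ := HeightOneSpectrum.exists_isArithFrobAt_of_mem_primesAbove_holds h𝔓
  have hFrob : ∀ {Φ : absoluteGaloisGroup K}, IsArithFrobAt (𝓞 K) Φ 𝔓 → ∀ z, Φ • e₁ z = e₁ z :=
    fun hΦ z ↦ smul_algHom_eq_self_of_mem_splitPrimes e₁ hsplit h𝔓 hΦ z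
  have hIner : ∀ i ∈ 𝔓.inertia (absoluteGaloisGroup K), ∀ z, i • e₁ z = e₁ z := by
    intro i hi z
    have h1 : (i * F) • e₁ z = e₁ z := hFrob ((isArithFrobAt_mul_iff_of_mem_inertia hi).mpr hF) z
    rw [mul_smul, hFrob hF z] at h1
    exact h1
  have hpow : ∀ (n : ℕ) z, (F ^ n) • e₁ z = e₁ z := by
    intro n z
    induction n with
    | zero => rw [pow_zero, one_smul]
    | succ n ih => rw [pow_succ, mul_smul, hFrob hF z, ih]
  -- the open subgroup fixing `e₁(K[1])`
  haveI : FiniteDimensional K e₁.fieldRange :=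
    LinearEquiv.finiteDimensional (AlgEquiv.ofInjectiveField e₁).toLinearEquiv
  let U : Subgroup (absoluteGaloisGroup K) := e₁.fieldRange.fixingSubgroup
  have hU : IsOpen (U : Set (absoluteGaloisGroup K)) := IntermediateField.fixingSubgroup_isOpen e₁.fieldRange
  obtain ⟨n, i, u, hi, hu, rfl⟩ := exists_eq_frobenius_pow_mul_of_mem_decompositionSubgroup h𝔓 hF hU hd
  have huz : u • e₁ y = e₁ y := by
    have hy : e₁ y ∈ e₁.fieldRange := ⟨y, rfl⟩
    exact (mem_fixingSubgroup_iff_forall_smul e₁.fieldRange u).mp hu ⟨e₁ y, hy⟩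
  rw [mul_smul, mul_smul, huz, hIner i hi, hpow]

/-! ## §2 Good reduction at `λ ∤ p`: the local inertia group acts trivially on `E[n]` -/

/-- **`E/K` has good reduction at the place `λ` above a Kolyvagin prime `ℓ`, and `λ ∤ p^k`** (`ℓ ∤ N`:
`f_ℓ = 0`, Silverman ATAEC IV.10.2(a), tree `hasGoodReductionAt_rat_of_not_dvd_conductorNorm` +
`hasGoodReductionAt_baseChange_of_hasGoodReductionAt_rat`; `ℓ ≠ p`). General-`p` form of
`KolyLocal.hasGoodReductionAt_of_kolyvagin`. [cite: Silverman1994, IV.10.2(a)] [cite: WZhang2014, Notations (xii)] -/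
theorem hasGoodReductionAt_of_zhangKolyvagin {p ℓ : ℕ} (hp : p.Prime)
    (hℓ : Zhang2014.IsKolyvaginPrime (W.conductorNorm ℤ) W K p ℓ)
    (w : HeightOneSpectrum (𝓞 K)) (hw : (ℓ : 𝓞 K) ∈ w.asIdeal) (k : ℕ) :
    (W.baseChange K).HasGoodReductionAt w ∧ ((((p ^ k : ℕ) : ℤ) : 𝓞 K) ∉ w.asIdeal) := by
  obtain ⟨hℓprime, hℓN, -, hℓp, -, -⟩ := hℓ
  have hℓw : (ℓ : 𝓞 ℚ) ∈ (w.under (𝓞 ℚ)).asIdeal := by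
    change (ℓ : 𝓞 ℚ) ∈ w.asIdeal.under (𝓞 ℚ)
    rw [Ideal.under_def, Ideal.mem_comap, map_natCast]; exact hw
  haveI : w.asIdeal.LiesOver (w.under (𝓞 ℚ)).asIdeal := ⟨rfl⟩
  refine ⟨hasGoodReductionAt_baseChange_of_hasGoodReductionAt_rat W (w.under (𝓞 ℚ)) w
      (LocalFrob.hasGoodReductionAt_rat_of_not_dvd_conductorNorm W hℓprime hℓN _ hℓw), ?_⟩
  rw [Int.cast_natCast, Nat.cast_pow]
  intro h
  exact not_mem_asIdeal_of_coprime K ((Nat.coprime_primes hℓprime hp).mpr hℓp) w hw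
    (w.isPrime.mem_of_pow_mem k h)

/-- **The local inertia group `I_{K_λ}` acts trivially on `E[p^k]`** at the place `λ` of a Kolyvagin prime
(good reduction at `λ ∤ p`, Silverman VII.4.1; local–global inertia `GaloisRep.isUnramifiedAt_iff_toLocal_holds`).
[cite: SilvermanAEC2009, Prop. VII.4.1] -/
theorem toLocal_apply_eq_of_mem_absInertia {p ℓ : ℕ} (hp : p.Prime)
    (hℓ : Zhang2014.IsKolyvaginPrime (W.conductorNorm ℤ) W K p ℓ)
    (v : HeightOneSpectrum (𝓞 K)) (hv : (ℓ : 𝓞 K) ∈ v.asIdeal) (k : ℕ)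
    (t : absoluteGaloisGroup (v.adicCompletion K)) (ht : t ∈ absInertia (v.adicCompletion K))
    (m : geomTorsion (W.baseChange K) ((p ^ k : ℕ) : ℤ)) :
    GaloisRep.toLocal v ((W.baseChange K).torsionGaloisModule ((p ^ k : ℕ) : ℤ)) t m = m := by
  obtain ⟨hgood, hpk⟩ := hasGoodReductionAt_of_zhangKolyvagin W K hp hℓ v hv k
  have hur : GaloisRep.IsUnramifiedAt v ((W.baseChange K).torsionGaloisModule ((p ^ k : ℕ) : ℤ)) :=
    fun 𝔓 h𝔓 τ hτ ↦ LinearMap.ext fun P ↦ (W.baseChange K).smul_geomTorsion_eq_of_mem_inertia hgood hpk h𝔓 hτ P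
  have h := (GaloisRep.isUnramifiedAt_iff_toLocal_holds v
    ((W.baseChange K).torsionGaloisModule ((p ^ k : ℕ) : ℤ))).1 hur t ht
  rw [h]
  rfl

/-! ## §3 The character `Φ : Γ_{K_λ} → G_ℓ = Gal(K[ℓ]/K[1])`, onto already on inertia -/

omit [W.IsElliptic] [W.IsGloballyMinimal] in
/-- The place `λ = (ℓ)` of an inert prime is the ONLY place containing `ℓ`. [folklore] -/
theorem eq_of_natCast_mem_of_isPrime_span {ℓ : ℕ} (hℓp : ℓ.Prime) (hℓP : (Ideal.span {(ℓ : 𝓞 K)}).IsPrime)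
    (v v' : HeightOneSpectrum (𝓞 K)) (hv : (ℓ : 𝓞 K) ∈ v.asIdeal) (hv' : (ℓ : 𝓞 K) ∈ v'.asIdeal) :
    v' = v := by
  have hne : Ideal.span {(ℓ : 𝓞 K)} ≠ ⊥ := by
    rw [Ne, Ideal.span_singleton_eq_bot]; exact_mod_cast hℓp.ne_zero
  have h1 := (hℓP.isMaximal hne).eq_of_le v.isPrime.ne_top ((Ideal.span_singleton_le_iff_mem _).mpr hv)
  have h2 := (hℓP.isMaximal hne).eq_of_le v'.isPrime.ne_top ((Ideal.span_singleton_le_iff_mem _).mpr hv')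
  exact HeightOneSpectrum.ext (h2.symm.trans h1)

omit [W.IsElliptic] [W.IsGloballyMinimal] in
/-- **THE CHARACTER `Φ : Γ_{K_λ} →* G_ℓ`.** `K` imaginary quadratic with `d_K < −4`, `ι : K → ℂ`, `ℓ` an inert
rational prime (`(ℓ)` prime in `𝓞 K`), `v = λ` its place, `e₀ : K[ℓ] → K̄` a `K`-embedding. There is a group
homomorphism `Φ` from `Γ_{K_v}` to `G_ℓ = Gal(K[ℓ]/K[1]) = ringClassGalOver ι ℓ 1` (cyclic of order `ℓ + 1`,
`isCyclic_ringClassGalOver` / `card_ringClassGalOver_eq_succ`) such that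
(a) `Φ d = 1 ↔ d|_{K̄}` fixes `e₀(K[ℓ])` pointwise (restriction `KolyvaginH44.exists_absGaloisRestrict`; the image
lies in `G_ℓ` because the decomposition group fixes `K[1]`, §1);
(b) every value of `Φ` is attained on the inertia group `I_{K_v}` — `λ` is TOTALLY RAMIFIED in `K[ℓ]/K[1]`
(`RingClassTower.exists_mem_inertia_smul_eq_of_mem_ringClassGalOver`, Gross §3 p. 218 l. 1) and the inertia group of
the prime `𝔓₀ ∣ λ` cut out by `K̄ → K̄_v` is the image of `I_{K_v}` (Neukirch II (9.6),
`exists_absGaloisRestrict_eq_of_mem_inertia`); in particular `Φ` is onto.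
[cite: GrossLMS1991, §3 (p. 218 l. 1), §4] [cite: NeukirchANT1999, Ch. II §9 Prop. (9.6)]
[cite: CasselsFrohlichANT1967, Ch. VII §1.1] -/
theorem exists_ringClassCharacter (hK : IsImaginaryQuadratic K) (hD : NumberField.discr K < -4) (ι : K →+* ℂ)
    {ℓ : ℕ} (hℓp : ℓ.Prime) (hℓP : (Ideal.span {(ℓ : 𝓞 K)}).IsPrime) (v : HeightOneSpectrum (𝓞 K))
    (hv : (ℓ : 𝓞 K) ∈ v.asIdeal) (e₀ : ringClassField K ι ℓ →ₐ[K] AlgebraicClosure K) :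
    ∃ Φ : absoluteGaloisGroup (v.adicCompletion K) →* ringClassGalOver ι ℓ 1,
      (∀ d, Φ d = 1 ↔ ∀ x : ringClassField K ι ℓ, absGaloisRestrict K (v.adicCompletion K) d • e₀ x = e₀ x) ∧
      (∀ d, ∃ t ∈ absInertia (v.adicCompletion K), Φ t = Φ d) ∧
      Function.Surjective Φ ∧ IsCyclic (ringClassGalOver ι ℓ 1) ∧
      Nat.card (ringClassGalOver ι ℓ 1) = ℓ + 1 := by
  have hℓ0 : ℓ ≠ 0 := hℓp.ne_zero
  haveI := (finiteDimensional_and_isGalois_ringClassField hK ι hℓ0).1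
  haveI := (finiteDimensional_and_isGalois_ringClassField hK ι hℓ0).2
  haveI := (finiteDimensional_and_isGalois_ringClassField hK ι one_ne_zero).1
  -- cyclicity and order of `G_ℓ`
  have hcycG : IsCyclic (ringClassGalOver ι ℓ 1) := by
    have h := RingClassGalOverCyclic.isCyclic_ringClassGalOver hK ι (ℓ := ℓ) (m' := 1) one_ne_zero hℓp
      (fun h ↦ hℓp.one_lt.ne' (Nat.dvd_one.mp h)) hℓP
    rwa [Nat.mul_one] at h
  have hcardG : Nat.card (ringClassGalOver ι ℓ 1) = ℓ + 1 := by
    have h := RingClassTower.card_ringClassGalOver_eq_succ hK ι hℓp hℓP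
      (fun h ↦ hℓp.one_lt.ne' (Nat.dvd_one.mp h)) one_ne_zero (Or.inr hD)
    rwa [Nat.mul_one] at h
  -- the restriction `π : Γ_K → Gal(K[ℓ]/K)` along `e₀`
  obtain ⟨π, hπ⟩ := KolyvaginH44.exists_absGaloisRestrict hK ι ℓ e₀
  -- a prime `𝔓₁ ∣ λ` with `res Γ_{K_v} ⊆ G_{𝔓₁}`
  obtain ⟨𝔐, h𝔐⟩ := v.localPrimesAbove_nonempty
  have h𝔓₁ : v.primeBelow (closureEmb (K := K) (v.adicCompletion K)) 𝔐 ∈ v.primesAbove :=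
    HeightOneSpectrum.primeBelow_mem_primesAbove h𝔐
  have hres : ∀ s : absoluteGaloisGroup (v.adicCompletion K),
      absGaloisRestrict K (v.adicCompletion K) s ∈
        (v.primeBelow (closureEmb (K := K) (v.adicCompletion K)) 𝔐).decompositionSubgroup
          (absoluteGaloisGroup K) := fun s ↦ by
    rw [← resGal_eq_absGaloisRestrict, resGal_eq]
    exact resGalOfEmb_mem_decompositionSubgroup _ h𝔐 s
  -- the image of `π ∘ res` lies in `G_ℓ`
  have h1ℓ : ringClassField K ι 1 ≤ ringClassField K ι ℓ := ringClassField_mono hK ι (one_dvd ℓ) hℓ0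
  let Ψ : absoluteGaloisGroup (v.adicCompletion K) →* (ringClassField K ι ℓ ≃ₐ[ℚ] ringClassField K ι ℓ) :=
    (ringClassGal ι ℓ).subtype.comp (π.comp (absGaloisRestrict K (v.adicCompletion K)).toMonoidHom)
  have hΨ : ∀ s, Ψ s = (π (absGaloisRestrict K (v.adicCompletion K) s) :
      ringClassField K ι ℓ ≃ₐ[ℚ] ringClassField K ι ℓ) := fun _ ↦ rfl
  have himg : ∀ s : absoluteGaloisGroup (v.adicCompletion K), Ψ s ∈ ringClassGalOver ι ℓ 1 := by
    intro s
    rw [hΨ, ringClassGalOver, mem_fixingSubgroup_iff]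
    intro z hz
    rw [AlgEquiv.smul_def]
    obtain ⟨z₁, hz₁⟩ : ∃ z₁ : ringClassField K ι 1, RingClassField.inclusion ι h1ℓ z₁ = z :=
      ⟨⟨(z : ℂ), hz⟩, Subtype.ext (RingClassField.coe_inclusion ι h1ℓ _)⟩
    have key : e₀ ((π (absGaloisRestrict K (v.adicCompletion K) s) :
        ringClassField K ι ℓ ≃ₐ[ℚ] ringClassField K ι ℓ) z) = e₀ z := by
      rw [← hπ, ← hz₁]
      exact smul_ringClassFieldOne_eq_self_of_mem_decompositionSubgroup K hK ι hℓp hℓP v hv h𝔓₁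
        (e₀.comp (RingClassField.inclusion ι h1ℓ)) (hres s) z₁
    exact e₀.injective key
  -- the character
  let Φ : absoluteGaloisGroup (v.adicCompletion K) →* ringClassGalOver ι ℓ 1 :=
    Ψ.codRestrict (ringClassGalOver ι ℓ 1) himg
  have hΦ : ∀ s, ((Φ s : ringClassGalOver ι ℓ 1) : ringClassField K ι ℓ ≃ₐ[ℚ] ringClassField K ι ℓ) =
      (π (absGaloisRestrict K (v.adicCompletion K) s) : ringClassField K ι ℓ ≃ₐ[ℚ] ringClassField K ι ℓ) :=
    fun _ ↦ rfl
  -- (a) the kernel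
  have hker : ∀ d, Φ d = 1 ↔
      ∀ x : ringClassField K ι ℓ, absGaloisRestrict K (v.adicCompletion K) d • e₀ x = e₀ x := by
    intro d
    constructor
    · intro h x
      rw [hπ, ← hΦ, h, OneMemClass.coe_one, AlgEquiv.one_apply]
    · intro h
      apply Subtype.ext
      rw [hΦ, OneMemClass.coe_one]
      refine AlgEquiv.ext fun x ↦ ?_
      have key : e₀ ((π (absGaloisRestrict K (v.adicCompletion K) d) :
          ringClassField K ι ℓ ≃ₐ[ℚ] ringClassField K ι ℓ) x) =
          e₀ ((1 : ringClassField K ι ℓ ≃ₐ[ℚ] ringClassField K ι ℓ) x) := by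
        rw [← hπ, h x, AlgEquiv.one_apply]
      exact e₀.injective key
  -- (b) onto on inertia: total ramification of `λ` in `K[ℓ]/K[1]` + `I_{𝔓₀} = res I_{K_v}`
  have hw1 := adicCompletion_valuation_le_one_iff K v
  have hO := norm_algebraMap_ringOfIntegers_le_one K v
  have hvlt := norm_algebraMap_ringOfIntegers_lt_one_iff K v
  have hdense : DenseRange (algebraMap K (v.adicCompletion K)) :=
    IsDedekindDomain.HeightOneSpectrum.denseRange_algebraMap (K := K) (v := v)
  obtain ⟨𝔓₀, h𝔓₀⟩ := exists_ideal_forall_mem_iff_spectralNorm_lt_one K (v.adicCompletion K) hO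
  have h𝔓₀v : 𝔓₀ ∈ v.primesAbove := mem_primesAbove_of_forall_mem_iff v hvlt 𝔓₀ h𝔓₀
  have hv₀ : ∀ v' : HeightOneSpectrum (𝓞 K), ((ℓ : ℕ) : 𝓞 K) ∈ v'.asIdeal ↔ v' = v :=
    fun v' ↦ ⟨fun h ↦ eq_of_natCast_mem_of_isPrime_span K hℓp hℓP v v' hv h, fun h ↦ h ▸ hv⟩
  have hinert : ∀ g : ringClassGalOver ι ℓ 1, ∃ t ∈ absInertia (v.adicCompletion K), Φ t = g := by
    intro g
    have hg' : (g : ringClassField K ι ℓ ≃ₐ[ℚ] ringClassField K ι ℓ) ∈ ringClassGalOver ι ℓ (ℓ / ℓ) := by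
      rw [Nat.div_self hℓp.pos]; exact g.2
    obtain ⟨τ, hτ, hτg⟩ := RingClassTower.exists_mem_inertia_smul_eq_of_mem_ringClassGalOver hK ι hℓ0 hℓp
      (dvd_refl ℓ) (by rw [Nat.div_self hℓp.pos]; exact fun h ↦ hℓp.one_lt.ne' (Nat.dvd_one.mp h)) hv₀ h𝔓₀v
      e₀ hg'
    obtain ⟨t, ht, rfl⟩ := exists_absGaloisRestrict_eq_of_mem_inertia hw1 hdense hO
      (exists_norm_algebraMap_adicCompletion_lt_one K v) 𝔓₀ h𝔓₀
      (HeightOneSpectrum.isMaximal_of_mem_primesAbove h𝔓₀v) hτ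
    refine ⟨t, ht, Subtype.ext (AlgEquiv.ext fun x ↦ ?_)⟩
    have key : e₀ (((Φ t : ringClassGalOver ι ℓ 1) : ringClassField K ι ℓ ≃ₐ[ℚ] ringClassField K ι ℓ) x) =
        e₀ ((g : ringClassField K ι ℓ ≃ₐ[ℚ] ringClassField K ι ℓ) x) := by
      rw [hΦ, ← hπ, hτg]
    exact e₀.injective key
  refine ⟨Φ, hker, fun d ↦ hinert (Φ d), fun g ↦ ?_, hcycG, hcardG⟩
  obtain ⟨t, -, ht⟩ := hinert g
  exact ⟨t, ht⟩

omit [W.IsElliptic] [W.IsGloballyMinimal] in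
/-- **The kernel of `Φ` is the image of `Γ_{K[ℓ]_{w'}} → Γ_{K_λ}` for EVERY place `w' ∣ λ` of `K[ℓ]`**
(`SemiLocal.mem_range_absGaloisRestrict_adicCompletion_iff`: that image is the group of the compositum `K_λ(K[ℓ])`,
i.e. the `d` whose restriction fixes `e₀(K[ℓ])`). So Jetchev's `H¹_tr(K_λ) := H¹(K[ℓ]_λ/K_λ, ·)` and the tree's
`transverseSubgroup (·|_{K_λ}) (K[ℓ]_{w'})` are the classes principal on `ker Φ`, for any `w'`.
[cite: CasselsFrohlichANT1967, Ch. VII §1.1] [cite: Jetchev2008, §3.1.2 (p. 814)] -/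
theorem ringClassCharacter_eq_one_iff_mem_range (hK : IsImaginaryQuadratic K) (ι : K →+* ℂ) {ℓ : ℕ}
    (hℓ0 : ℓ ≠ 0) (v : HeightOneSpectrum (𝓞 K)) (e₀ : ringClassField K ι ℓ →ₐ[K] AlgebraicClosure K)
    [NumberField (ringClassField K ι ℓ)]
    {G : Type*} [Group G] (Φ : absoluteGaloisGroup (v.adicCompletion K) →* G)
    (hker : ∀ d, Φ d = 1 ↔ ∀ x : ringClassField K ι ℓ, absGaloisRestrict K (v.adicCompletion K) d • e₀ x = e₀ x)
    (w' : HeightOneSpectrum (𝓞 (ringClassField K ι ℓ))) [w'.asIdeal.LiesOver v.asIdeal]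
    (d : absoluteGaloisGroup (v.adicCompletion K)) :
    letI := (adicCompletionOfLiesOver K (ringClassField K ι ℓ) v w').toAlgebra
    Φ d = 1 ↔ d ∈ Set.range (absGaloisRestrict (v.adicCompletion K) (w'.adicCompletion (ringClassField K ι ℓ))) := by
  haveI := (finiteDimensional_and_isGalois_ringClassField hK ι hℓ0).2
  rw [hker d, SemiLocal.mem_range_absGaloisRestrict_adicCompletion_iff v e₀ w' d]

end Summit.BirchSwinnertonDyer.Rank1Residual.JET.RingClassTransverse

end
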